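import Literature.AnabelianGeometry.SemiGraphs.CoveringBranchFrames
import Literature.AnabelianGeometry.SemiGraphs.VertexAlignedStabilizers

/-!
# Branch alignment pins the local base point at an EDGE: equal stabilisers, hence injective edge
# section maps ([SemiAnbd] Def. 2.2 (i) p. 23, Rem. 2.2.1 p. 24, Rem. 2.4.2 p. 26)

Mochizuki, *Semi-graphs of anabelioids*, Publ. RIMS **42** (2006) 221–322, §2: Def. 2.2 (i) p. 23 (the
finite étale covering `𝒢′ → 𝒢` attached to `A ∈ B(𝒢)`: LOCALLY `𝒢′_{e′} = (𝒢_e)_Q` for a connected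
component `Q` of `A_e` lying under the component `P` of `A_v` through the gluing `ψ_b`), Rem. 2.2.1
p. 24 ("the image of each `Π_v` [resp. `Π_b`] … is equal to the stabilizer …"), Rem. 2.4.2 p. 26 (the
2-cells `φ_{b′}` of a morphism) [cite: MochizukiSemiAnbd2006, Rem. 2.2.1 p.24].

PROOF-ONLY companion (abc-iut cell, layer L3; FACT-LIST row F-1478 `remark_2_4_1_covering`, residual
(L)/(J1) «print's finite étale coverings compose / abstract-covering rigidity», EDGE analogue **(E-σ)** of
abc-iut-w4-d079's `VertexAlignedStabilizers.lean`; seat abc-iut-f-161).  For a covering `φ : 𝒢′ → 𝒢` the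
local witness at an edge `e′ ↦ e` and the local witness at an abutting vertex `v′ ↦ v` are INDEPENDENT
data, and so is the global witness; abc-iut-w4-d079 showed that VERTEX alignment ties the vertex base
point `p₀ ∈ F(P)` to the global one `a₀ ∈ F(A_v)` (`Stab_{Π_v}(a₀) = Stab_{Π_v}(p₀)`).  This file is the
GROUP HALF of the edge statement: BRANCH alignment (clause (i) of `Hom.IsBranchAligned`, abc-iut-L4-t17)
ties the edge base point `q₀ ∈ F_e(Q)` to the vertex one, read in `Π_e` through the gluing
`A_e ≅ b^* A_v` and the ALIGNED FRAME `Hom.alignIso` (the frame in which the square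
`Π_{e′} → Π_{v′} → Π_v` = `Π_{e′} → Π_e → Π_v` commutes on the nose, `autMulEquivOfIso_alignIso_pi1Map`):

* `comap_range_eq_range_of_branchAligned` — pure group theory: along a commuting square
  `k ∘ ι_e = ι_v ∘ br` (`br : Π_{e′} → Π_{v′}` the branch map of `𝒢′`, `k : Π_e → Π_v` that of `𝒢` in the
  aligned frame), clause (i) in abc-iut-L4-t17's equality form `ι_v(br(Π_{e′})) = ι_v(Π_{v′}) ⊓ k(Π_e)`
  together with `ker k ≤ ι_e(Π_{e′})` gives `k⁻¹(ι_v(Π_{v′})) = ι_e(Π_{e′})`;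
* `comap_frame_stabilizer` — for any frame `α : b^* ⋙ F_e ≅ F` and gluing `ψ : b^* X ≅ Y`, the
  `Π_v`-stabiliser of `x ∈ F(X)` pulls back along `k = Aut(α) ∘ π₁(b^*)` to the `Π_e`-stabiliser of the
  transported point `x^e := F_e(ψ)(α⁻¹ x) ∈ F_e(Y)`;
* `ker_frame_le_stabilizer` — `ker k` fixes every point of `F_e(Q)` for `Q ↪ Y ≅ b^* X`;
* `Hom.IsBranchAligned.edge_stabilizer_eq_of_ranges` — **for a branch-aligned `φ`, at a branch `b′` of
  `e′` abutting to `v′`: if `x ∈ F(A_v)` has `Π_v`-stabiliser `ι_v(Π_{v′})` (the vertex base point — the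
  local one `p₀`, or, under vertex alignment, the global one `a₀`) and `q₀ ∈ F_e(Q)`, `Q ↪ A_e`, has
  `Π_e`-stabiliser `ι_e(Π_{e′})` (the edge base point), then `Stab_{Π_e}(x^e) = Stab_{Π_e}(q₀)`**;
* `Hom.IsBranchAligned.edge_mono_of_map_eq` — **hence every `σ : Q ⟶ A_e` with `F_e(σ)(q₀) = x^e`, `Q`
  connected, is a monomorphism** (abc-iut-w4-d079's `mono_of_stabilizer_le`); the consumer instantiates
  `σ :=` the edge section map of abc-iut-w5-d041's decomposition (brick (L-σ) at edges, memo §4) /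
  the (★★E) step of (J1);
* `Hom.IsBranchAligned.edge_stabilizer_eq_of_global` — the same with `x := a₀` the GLOBAL base point
  ((D1) `covering_decompositionGroup_of_isGlobalCoveringOf`), for `φ` branch- AND vertex-aligned, via
  abc-iut-w4-d079's `Hom.IsVertexAligned.stabilizer_eq_of_ranges`.

No `def`, no new `Prop`; nothing here takes a side on [IUTchIII] Cor. 3.12.
-/

namespace Literature.AnabelianGeometry.SemiGraphs

open CategoryTheory CategoryTheory.Limits CategoryTheory.PreGaloisCategory
open Literature.AnabelianGeometry.Anabelioids
open scoped Pointwise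

universe w v₁ u₁ u

/-! ### Part A. Group theory of the branch-aligned square -/

section GroupTheory

variable {Γf Γe Γw Γu : Type*} [Group Γf] [Group Γe] [Group Γw] [Group Γu]

/-- **The branch-aligned square pins the preimage.**  For homomorphisms `ι_v : Π_{v′} → Π_v`,
`k : Π_e → Π_v`, `br : Π_{e′} → Π_{v′}`, `ι_e : Π_{e′} → Π_e` with `k ∘ ι_e = ι_v ∘ br`, if
`ι_v(br(Π_{e′})) = ι_v(Π_{v′}) ⊓ k(Π_e)` (clause (i) of branch alignment, equality form) and
`ker k ≤ ι_e(Π_{e′})`, then `k⁻¹(ι_v(Π_{v′})) = ι_e(Π_{e′})`. [cite: MochizukiSemiAnbd2006, Rem. 2.2.1 p.24] -/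
theorem comap_range_eq_range_of_branchAligned (ιv : Γw →* Γu) (k : Γe →* Γu) (br : Γf →* Γw)
    (ιe : Γf →* Γe) (hsq : ∀ x, k (ιe x) = ιv (br x))
    (hal : br.range.map ιv = ιv.range ⊓ k.range) (hker : k.ker ≤ ιe.range) :
    ιv.range.comap k = ιe.range := by
  apply le_antisymm
  · intro g hg
    have h1 : k g ∈ br.range.map ιv := by
      rw [hal]
      exact ⟨hg, ⟨g, rfl⟩⟩
    obtain ⟨_, ⟨x, rfl⟩, hx⟩ := h1
    have h2 : g * (ιe x)⁻¹ ∈ k.ker := by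
      rw [MonoidHom.mem_ker, map_mul, map_inv, hsq, hx, mul_inv_cancel]
    have h3 : g = g * (ιe x)⁻¹ * ιe x := by group
    rw [h3]
    exact mul_mem (hker h2) ⟨x, rfl⟩
  · rintro _ ⟨x, rfl⟩
    change k (ιe x) ∈ ιv.range
    rw [hsq]
    exact ⟨br x, rfl⟩

end GroupTheory

/-! ### Part B. Frames: stabilisers and kernels through `Aut(α) ∘ π₁(b^*)` -/

section Frame

variable {C : Type*} [Category C] {D : Type*} [Category D] (b : C ⥤ D)
  (Fe : D ⥤ FintypeCat.{w}) (F : C ⥤ FintypeCat.{w}) (α : b ⋙ Fe ≅ F)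

/-- **Stabilisers through a frame.**  For a frame `α : b^* ⋙ F_e ≅ F` (identifying the basepoint of
`𝒢_v` induced from the edge with `F`) and a gluing `ψ : b^* X ≅ Y`, the `Aut F`-stabiliser of a point
`x ∈ F(X)` pulls back along `k = Aut(α) ∘ π₁(b^*) : Aut F_e → Aut F` to the `Aut F_e`-stabiliser of the
transported point `F_e(ψ)(α⁻¹_X x) ∈ F_e(Y)`. [cite: MochizukiSemiAnbd2006, Rem. 2.2.1 p.24] -/
theorem comap_frame_stabilizer {X : C} {Y : D} (ψ : b.obj X ≅ Y) (x : F.obj X) :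
    (MulAction.stabilizer (Aut F) x).comap
        ((Aut.autMulEquivOfIso α).toMonoidHom.comp (pi1Map b Fe)) =
      MulAction.stabilizer (Aut Fe) (Fe.map ψ.hom (α.inv.app X x)) := by
  ext γ
  rw [Subgroup.mem_comap, MulAction.mem_stabilizer_iff, MulAction.mem_stabilizer_iff]
  have key : ((Aut.autMulEquivOfIso α).toMonoidHom.comp (pi1Map b Fe)) γ • x =
      α.hom.app X (γ • (show Fe.obj (b.obj X) from α.inv.app X x)) := rfl
  rw [key, mulAction_naturality]
  have h0 : ∀ w : F.obj X, α.hom.app X (α.inv.app X w) = w := fun w => by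
    rw [← FintypeCat.comp_apply, Iso.inv_hom_id_app, FintypeCat.id_apply]
  have h0' : ∀ w : Fe.obj (b.obj X), α.inv.app X (α.hom.app X w) = w := fun w => by
    rw [← FintypeCat.comp_apply, Iso.hom_inv_id_app]
    rfl
  constructor
  · intro h
    have h' : γ • (show Fe.obj (b.obj X) from α.inv.app X x) = α.inv.app X x := by
      have h1 := congrArg (α.inv.app X) h
      rwa [h0'] at h1
    rw [h']
  · intro h
    haveI : Mono (Fe.map ψ.hom) := inferInstance
    have hinj : Function.Injective (Fe.map ψ.hom) :=
      ConcreteCategory.injective_of_mono_of_preservesPullback _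
    have h' : γ • (show Fe.obj (b.obj X) from α.inv.app X x) = α.inv.app X x := hinj h
    rw [h', h0]

/-- **The kernel of a frame map fixes the points under the gluing.**  If `k(γ) = 1` for
`k = Aut(α) ∘ π₁(b^*)`, then `γ` acts trivially on `F_e(b^* X)`, hence on `F_e(Y)` for `Y ≅ b^* X`, hence
on `F_e(Q)` for every `Q ↪ Y` (`F_e` preserving the monomorphism). [cite: MochizukiSemiAnbd2006, Rem. 2.2.1 p.24] -/
theorem ker_frame_le_stabilizer [Fe.PreservesMonomorphisms] {X : C} {Y : D} (ψ : b.obj X ≅ Y)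
    {Q : D} (m : Q ⟶ Y) [Mono m] (q : Fe.obj Q) :
    ((Aut.autMulEquivOfIso α).toMonoidHom.comp (pi1Map b Fe)).ker ≤
      MulAction.stabilizer (Aut Fe) q := by
  intro γ hγ
  rw [MulAction.mem_stabilizer_iff]
  rw [MonoidHom.mem_ker, MonoidHom.comp_apply, MulEquiv.coe_toMonoidHom,
    MulEquiv.map_eq_one_iff] at hγ
  have h2 : γ.hom.app (b.obj X) = 𝟙 _ := by
    have h := congrArg (fun τ : Aut (b ⋙ Fe) => τ.hom.app X) hγ
    simp only [pi1Map_hom_app] at h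
    exact h
  -- trivial on `F_e(Y)` through the gluing
  have h3 : γ.hom.app Y = 𝟙 _ := by
    have hnat := γ.hom.naturality ψ.hom
    rw [h2, Category.id_comp] at hnat
    exact (cancel_epi (Fe.map ψ.hom)).mp (hnat.trans (Category.comp_id _).symm)
  -- hence on `F_e(Q) ↪ F_e(Y)`
  haveI : Mono (Fe.map m) := inferInstance
  have hinj : Function.Injective (Fe.map m) :=
    ConcreteCategory.injective_of_mono_of_preservesPullback _
  apply hinj
  rw [← mulAction_naturality, mulAction_def, h3, FintypeCat.id_apply]

end Frame

/-! ### Part C. The covering: equal edge stabilisers from branch alignment -/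

namespace SemiGraphOfAnabelioids

namespace Hom

variable {𝒢 𝒢' : SemiGraphOfAnabelioids.{v₁, u₁, u}} {φ : Hom 𝒢' 𝒢}

/-- The image edge of the edge of `b′` is the edge of the image branch (bookkeeping, as in
`Hom.alignIso`). [cite: MochizukiSemiAnbd2006, Rem. 2.4.2 p.26] -/
theorem edgeMap_edgeOf_of_branchMap (φ : Hom 𝒢' 𝒢) (b' : 𝒢'.graph.Branch) (b : 𝒢.graph.Branch)
    (p : φ.base.branchMap b' = b) : φ.base.edgeMap (𝒢'.graph.edgeOf b') = 𝒢.graph.edgeOf b := by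
  rw [← p]; exact (φ.base.edgeOf_branchMap b').symm

/-- **Branch alignment ⇒ equal edge stabilisers.**  Let `φ : 𝒢′ → 𝒢` be branch-aligned; fix a branch
`b′` of `e′` abutting to `v′`, over `b` (of `e`, abutting to `v = φ v′`), basepoints `F′` of `𝒢′_{v′}`,
`F_e′` of `𝒢′_{e′}` with a frame `α′ : b′^* ⋙ F_e′ ≅ F′`, and the induced basepoints
`F := φ_{v′}^* ⋙ F′`, `F_e := φ_{e′}^* ⋙ F_e′` in the ALIGNED frame `Hom.alignIso`.  If `x ∈ F(A_v)` has
`Π_v`-stabiliser `ι_v(Π_{v′})` and `q₀ ∈ F_e(Q)`, `Q ↪ A_e`, has `Π_e`-stabiliser `ι_e(Π_{e′})`, then the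
`Π_e`-stabiliser of the transported point `x^e = F_e(ψ_b)(alignIso⁻¹ x) ∈ F_e(A_e)` equals that of
`q₀`.  (Group theory of the aligned square: abc-iut-L4-t17's `map_branchSubgroup_eq_range_inf_aligned`,
`autMulEquivOfIso_alignIso_pi1Map`, and Part B.) [cite: MochizukiSemiAnbd2006, Rem. 2.2.1 p.24] -/
theorem IsBranchAligned.edge_stabilizer_eq_of_ranges (hal : φ.IsBranchAligned)
    (v' : 𝒢'.graph.Vertex) (F' : 𝒢'.V v' ⥤ FintypeCat.{v₁}) [FiberFunctor F']
    (b' : 𝒢'.graph.Branch) (h' : 𝒢'.graph.abuts b' = some v') (b : 𝒢.graph.Branch)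
    (p : φ.base.branchMap b' = b) (Fe' : 𝒢'.E (𝒢'.graph.edgeOf b') ⥤ FintypeCat.{v₁})
    [FiberFunctor Fe'] (α' : (𝒢'.pull b' v' h').pullback ⋙ Fe' ≅ F') {A : 𝒢.BObj}
    (x : ((φ.φV v').pullback ⋙ F').obj (A.S (φ.base.vertexMap v')))
    (hx : (pi1Map (φ.φV v').pullback F').range =
      MulAction.stabilizer (Aut ((φ.φV v').pullback ⋙ F')) x)
    {Q : 𝒢.E (𝒢.graph.edgeOf b)} (m : Q ⟶ A.T (𝒢.graph.edgeOf b)) [Mono m]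
    (q₀ : ((φ.φE (𝒢'.graph.edgeOf b') (𝒢.graph.edgeOf b)
      (φ.edgeMap_edgeOf_of_branchMap b' b p)).pullback ⋙ Fe').obj Q)
    (hq : (pi1Map (φ.φE (𝒢'.graph.edgeOf b') (𝒢.graph.edgeOf b)
        (φ.edgeMap_edgeOf_of_branchMap b' b p)).pullback Fe').range =
      MulAction.stabilizer _ q₀) :
    MulAction.stabilizer
        (Aut ((φ.φE (𝒢'.graph.edgeOf b') (𝒢.graph.edgeOf b)
          (φ.edgeMap_edgeOf_of_branchMap b' b p)).pullback ⋙ Fe'))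
        (((φ.φE (𝒢'.graph.edgeOf b') (𝒢.graph.edgeOf b)
            (φ.edgeMap_edgeOf_of_branchMap b' b p)).pullback ⋙ Fe').map
          (A.ψ b (φ.base.vertexMap v') (p ▸ φ.base.abuts_branchMap b' v' h')).hom
          ((φ.alignIso b' v' h' b p F' Fe' α').inv.app (A.S (φ.base.vertexMap v')) x)) =
      MulAction.stabilizer _ q₀ := by
  haveI : FiberFunctor ((φ.φE (𝒢'.graph.edgeOf b') (𝒢.graph.edgeOf b)
      (φ.edgeMap_edgeOf_of_branchMap b' b p)).pullback ⋙ Fe') := fiberFunctor_comp_of_exact _ Fe'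
  rw [← comap_frame_stabilizer
      (𝒢.pull b (φ.base.vertexMap v') (p ▸ φ.base.abuts_branchMap b' v' h')).pullback
      _ _ (φ.alignIso b' v' h' b p F' Fe' α')
      (A.ψ b (φ.base.vertexMap v') (p ▸ φ.base.abuts_branchMap b' v' h')) x, ← hx, ← hq]
  refine comap_range_eq_range_of_branchAligned _ _
    ((Aut.autMulEquivOfIso α').toMonoidHom.comp (pi1Map (𝒢'.pull b' v' h').pullback Fe')) _
    (fun σ => autMulEquivOfIso_alignIso_pi1Map φ b' v' h' b p F' Fe' α' σ) ?_ ?_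
  · exact map_branchSubgroup_eq_range_inf_aligned φ hal b' v' h' b p F' Fe' α'
  · rw [hq]
    exact ker_frame_le_stabilizer _ _ _ (φ.alignIso b' v' h' b p F' Fe' α')
      (A.ψ b (φ.base.vertexMap v') (p ▸ φ.base.abuts_branchMap b' v' h')) m q₀

/-- **Branch alignment ⇒ the edge section map is a monomorphism (group half of (E-σ)).**  In the
situation of `edge_stabilizer_eq_of_ranges`, every morphism `σ : Q ⟶ A_e` of `𝒢_e` with
`F_e(σ)(q₀) = x^e` and `Q` connected is a monomorphism. [cite: MochizukiSemiAnbd2006, Rem. 2.2.1 p.24] -/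
theorem IsBranchAligned.edge_mono_of_map_eq (hal : φ.IsBranchAligned)
    (v' : 𝒢'.graph.Vertex) (F' : 𝒢'.V v' ⥤ FintypeCat.{v₁}) [FiberFunctor F']
    (b' : 𝒢'.graph.Branch) (h' : 𝒢'.graph.abuts b' = some v') (b : 𝒢.graph.Branch)
    (p : φ.base.branchMap b' = b) (Fe' : 𝒢'.E (𝒢'.graph.edgeOf b') ⥤ FintypeCat.{v₁})
    [FiberFunctor Fe'] (α' : (𝒢'.pull b' v' h').pullback ⋙ Fe' ≅ F') {A : 𝒢.BObj}
    (x : ((φ.φV v').pullback ⋙ F').obj (A.S (φ.base.vertexMap v')))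
    (hx : (pi1Map (φ.φV v').pullback F').range =
      MulAction.stabilizer (Aut ((φ.φV v').pullback ⋙ F')) x)
    {Q : 𝒢.E (𝒢.graph.edgeOf b)} [PreGaloisCategory.IsConnected Q]
    (m : Q ⟶ A.T (𝒢.graph.edgeOf b)) [Mono m]
    (q₀ : ((φ.φE (𝒢'.graph.edgeOf b') (𝒢.graph.edgeOf b)
      (φ.edgeMap_edgeOf_of_branchMap b' b p)).pullback ⋙ Fe').obj Q)
    (hq : (pi1Map (φ.φE (𝒢'.graph.edgeOf b') (𝒢.graph.edgeOf b)
        (φ.edgeMap_edgeOf_of_branchMap b' b p)).pullback Fe').range =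
      MulAction.stabilizer _ q₀)
    (σ : Q ⟶ A.T (𝒢.graph.edgeOf b))
    (hσ : ((φ.φE (𝒢'.graph.edgeOf b') (𝒢.graph.edgeOf b)
        (φ.edgeMap_edgeOf_of_branchMap b' b p)).pullback ⋙ Fe').map σ q₀ =
      ((φ.φE (𝒢'.graph.edgeOf b') (𝒢.graph.edgeOf b)
          (φ.edgeMap_edgeOf_of_branchMap b' b p)).pullback ⋙ Fe').map
        (A.ψ b (φ.base.vertexMap v') (p ▸ φ.base.abuts_branchMap b' v' h')).hom
        ((φ.alignIso b' v' h' b p F' Fe' α').inv.app (A.S (φ.base.vertexMap v')) x)) :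
    Mono σ := by
  haveI : FiberFunctor ((φ.φE (𝒢'.graph.edgeOf b') (𝒢.graph.edgeOf b)
      (φ.edgeMap_edgeOf_of_branchMap b' b p)).pullback ⋙ Fe') := fiberFunctor_comp_of_exact _ Fe'
  refine mono_of_stabilizer_le _ σ q₀ ?_
  rw [hσ, hal.edge_stabilizer_eq_of_ranges v' F' b' h' b p Fe' α' x hx m q₀ hq]

/-- **Branch AND vertex alignment ⇒ the edge base point is tied to the GLOBAL base point.**  For `φ`
branch-aligned and vertex-aligned, with `a₀ ∈ F(A_v)` the global base point (`ι(Π_{𝒢′}) = Stab_{Π_𝒢}(a₀)`,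
(D1)), `p₀ ∈ F(P)`, `P ↪ A_v`, the vertex base point (`ι_v(Π_{v′}) = Stab_{Π_v}(p₀)`) and `q₀ ∈ F_e(Q)`,
`Q ↪ A_e`, the edge base point (`ι_e(Π_{e′}) = Stab_{Π_e}(q₀)`), all in the induced basepoints
`F = φ_{v′}^* ⋙ F′`, `F_e = φ_{e′}^* ⋙ F_e′` and the aligned frame: `Stab_{Π_e}(a₀^e) = Stab_{Π_e}(q₀)` for
the transported global point `a₀^e = F_e(ψ_b)(alignIso⁻¹ a₀)` — abc-iut-w4-d079's
`IsVertexAligned.stabilizer_eq_of_ranges` feeds `edge_stabilizer_eq_of_ranges`.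
[cite: MochizukiSemiAnbd2006, Rem. 2.2.1 p.24] -/
theorem IsBranchAligned.edge_stabilizer_eq_of_global (hal : φ.IsBranchAligned)
    (hva : φ.IsVertexAligned)
    (v' : 𝒢'.graph.Vertex) (F' : 𝒢'.V v' ⥤ FintypeCat.{v₁}) [FiberFunctor F']
    (b' : 𝒢'.graph.Branch) (h' : 𝒢'.graph.abuts b' = some v') (b : 𝒢.graph.Branch)
    (p : φ.base.branchMap b' = b) (Fe' : 𝒢'.E (𝒢'.graph.edgeOf b') ⥤ FintypeCat.{v₁})
    [FiberFunctor Fe'] (α' : (𝒢'.pull b' v' h').pullback ⋙ Fe' ≅ F') {A : 𝒢.BObj}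
    (a₀ : (𝒢.ρ (φ.base.vertexMap v') ⋙ ((φ.φV v').pullback ⋙ F')).obj A)
    (ha : ((Aut.autMulEquivOfIso (Functor.isoWhiskerLeft (𝒢.ρ (φ.base.vertexMap v'))
        (Iso.refl ((φ.φV v').pullback ⋙ F')))).toMonoidHom.comp
          (pi1Map φ.pullbackFunctor (𝒢'.ρ v' ⋙ F'))).range =
      MulAction.stabilizer (𝒢.Pi (φ.base.vertexMap v') ((φ.φV v').pullback ⋙ F')) a₀)
    {P : 𝒢.V (φ.base.vertexMap v')} (mP : P ⟶ A.S (φ.base.vertexMap v')) [Mono mP]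
    (p₀ : ((φ.φV v').pullback ⋙ F').obj P)
    (hp : ((Aut.autMulEquivOfIso (Iso.refl ((φ.φV v').pullback ⋙ F'))).toMonoidHom.comp
        (pi1Map (φ.φV v').pullback F')).range =
      MulAction.stabilizer (𝒢.PiV (φ.base.vertexMap v') ((φ.φV v').pullback ⋙ F')) p₀)
    {Q : 𝒢.E (𝒢.graph.edgeOf b)} (m : Q ⟶ A.T (𝒢.graph.edgeOf b)) [Mono m]
    (q₀ : ((φ.φE (𝒢'.graph.edgeOf b') (𝒢.graph.edgeOf b)
      (φ.edgeMap_edgeOf_of_branchMap b' b p)).pullback ⋙ Fe').obj Q)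
    (hq : (pi1Map (φ.φE (𝒢'.graph.edgeOf b') (𝒢.graph.edgeOf b)
        (φ.edgeMap_edgeOf_of_branchMap b' b p)).pullback Fe').range =
      MulAction.stabilizer _ q₀) :
    MulAction.stabilizer
        (Aut ((φ.φE (𝒢'.graph.edgeOf b') (𝒢.graph.edgeOf b)
          (φ.edgeMap_edgeOf_of_branchMap b' b p)).pullback ⋙ Fe'))
        (((φ.φE (𝒢'.graph.edgeOf b') (𝒢.graph.edgeOf b)
            (φ.edgeMap_edgeOf_of_branchMap b' b p)).pullback ⋙ Fe').map
          (A.ψ b (φ.base.vertexMap v') (p ▸ φ.base.abuts_branchMap b' v' h')).hom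
          ((φ.alignIso b' v' h' b p F' Fe' α').inv.app (A.S (φ.base.vertexMap v'))
            (show ((φ.φV v').pullback ⋙ F').obj (A.S (φ.base.vertexMap v')) from a₀))) =
      MulAction.stabilizer _ q₀ := by
  haveI : FiberFunctor ((φ.φV v').pullback ⋙ F') := fiberFunctor_comp_of_exact _ F'
  -- vertex alignment: `Stab_{Π_v}(a₀) = Stab_{Π_v}(p₀) = ι_v(Π_{v′})`
  have hst := hva.stabilizer_eq_of_ranges v' F' ((φ.φV v').pullback ⋙ F') (Iso.refl _) a₀ ha mP p₀ hp
  have hx : (pi1Map (φ.φV v').pullback F').range =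
      MulAction.stabilizer (Aut ((φ.φV v').pullback ⋙ F'))
        (show ((φ.φV v').pullback ⋙ F').obj (A.S (φ.base.vertexMap v')) from a₀) := by
    rw [hst, ← hp]
    ext y
    simp only [MonoidHom.mem_range, MonoidHom.coe_comp, Function.comp_apply, MulEquiv.coe_toMonoidHom]
    constructor
    · rintro ⟨z, rfl⟩
      exact ⟨z, Iso.ext (by simp [Aut.autMulEquivOfIso])⟩
    · rintro ⟨z, rfl⟩
      exact ⟨z, Iso.ext (by simp [Aut.autMulEquivOfIso])⟩
  exact hal.edge_stabilizer_eq_of_ranges v' F' b' h' b p Fe' α' _ hx m q₀ hq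

end Hom

end SemiGraphOfAnabelioids

end Literature.AnabelianGeometry.SemiGraphs
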